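import Summits.QuantumFields.YangMills.Theses.ConvexGribovBody
import Summits.QuantumFields.YangMills.Theses.FradkinShenkerFlow
import Summits.QuantumFields.YangMills.Theorems.ConvexGribovBodyCovarianceBoundDefs
import Summits.QuantumFields.YangMills.Theorems.FradkinShenkerFlowPoincareToClusteringDefs
import Summits.QuantumFields.YangMills.Theorems.ConvexGribovBodyBrascampLiebVacuumSCStubSliceRestriction
import Summits.QuantumFields.YangMills.Theorems.ConvexGribovBodyBrascampLiebVacuumSCStubFloorReduction
import Summits.QuantumFields.YangMills.Theorems.ConvexGribovBodyBrascampLiebVacuumSCStubOnelinkHS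
import Summits.QuantumFields.YangMills.Theorems.ConvexGribovBodyBrascampLiebVacuumSCFloor

/-!
# Crux `BrascampLiebVacuumSC` (stmt-QuantumFields-16404) via the line `SketchIdeator1` — skeleton v9
(lead c4 `prover-line-stmt-QuantumFields-16404-c4-0`, 2026-08-17; v1/v2 lead 0, v3/v4 lead c1, v5 lead c2,
v6 lead c3)

Route `ConvexGribovBody` of `YangMills`; crux (concluded BY NAME in `BrascampLiebVacuumSC_of`):
`Summit.QuantumFields.YangMills.Theses.ConvexGribovBody.BrascampLiebVacuumSC` — for simply-connected
compact simple `G` and faithful `r`, per `β ≥ β₀`, a volume-uniform Poincaré inequality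
`Var_μ f ≤ C(β) · Dmax(β,S) · dir f` for gauge-invariant link-Lipschitz functions `f` of the time-zero
spatial links under Wilson's measure `μ` on the torus `(2S+1)⁴`.

## The line (card `Ideas/up-slice-restriction.md`)

Per `β` the slice inequality is the restriction of the 4d uniform heat-bath Poincaré inequality UP(β) to
slice functions (`stub_up` + the LANDED `stub_sliceRestriction` p124378 / `stub_onelinkHS` p126464),
normalised by a volume-uniform FLOOR of the Coulomb covariance scale (`Dmax ≥ ∫ sup_h L⁻³Σ‖A^h‖²`, the
LANDED `stub_floorReduction` p124550, + the floor `floorCore` below).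

## The floor (v5, lead c2; v6, lead c3)

`Σ_ℓ ‖A^h_ℓ‖² ≥ n⁻³ Σ_z Q_n(U|_{cube z})` in any gauge (`stub_cubeOrbit` p130567, `stub_cubeCount` p130498),
block freeing (`stub_blockAvgFloor` p130807) and assembly (`stub_cubeGlue` p130951) give the floor at every `β`
on all tori `S ≥ n` from ONE property of `G`: a cube configuration not gauge-equivalent to an involution-valued
one (the cube witness), which Tonelli volume counting (`stub_cubeWitness_of_dimensionGap` p131883, lead c3)
derives from a HAAR DIMENSION GAP: ball growth `μ(B_ε) ≥ c ε^d`, thin involutions `μ(J_ε) ≤ C ε^m`, `d < 3m`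
(Frobenius distance via `ρ`; non-vacuity at `SU(2)`: `dimensionGap_su2_fundamental` p132704).

## v7 (lead c4): the dimension gap from METRIC ENTROPY — v7.1: all of it LANDED but one inequality

The Haar dimension gap is DERIVED (`dimensionGap`) from six stubs, five of which LANDED in wave 1 of lead c4:

* `stub_cartanChart` (LANDED p134669; von Neumann–Cartan closed-subgroup theorem, which the tree already
  held as `Literature.Analysis.Calculus.exists_exp_chart_range` + `QuantumLattice.repLieAlgebra`): the matrix
  Lie algebra `𝔥 = {X : exp(tX) ∈ ρ(G) ∀ t}` is an `ℝ`-subspace `V = repLieAlgebra r` and `exp` maps every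
  small ball of `𝔥` ONTO a neighbourhood of `1` in `ρ(G)` [Hall GTM 222, Thm 3.20 + Thm 3.42].
* `stub_euclidBalls` (LANDED p134625, volume argument): one finite `ε`-separated `ε`-net of the `s`-ball of a
  subspace `W` of the matrix space, of size `≍ ε^{−dim W}`.
* `stub_haarSandwich` (LANDED p134512): an `ε`-net of `G` of size `n` forces `n · μ(B_ε) ≥ 1`; `n` points
  pairwise `2ε` apart force `n · μ(B_ε) ≤ 1`.
* `stub_expLocal` (LANDED p134635): `exp` is bi-Lipschitz (constants 2) on a small Frobenius ball, and a
  near-involution `P e^X` (`P² = 1`, `(P e^X)² = 1`, `X` small) has `P X P = −X`.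
* `stub_gapAssembly` (LANDED p135435 + helpers p135288): the metric-entropy assembly — F1 ∧ F2 ∧ the three
  tools ⇒ the Haar dimension gap with `d = dim 𝔥`, `m = d − max_i dim(𝔥 ∩ 𝔭_{j_i})` over a finite `η`-net
  `(j_i)` of the involutions (`d > 0` as `G` is connected non-abelian; central `j_i` have `𝔭 = 0`).
* v7's `stub_involutionDim` (F2: for a non-central involution `j` of a simply-connected compact simple `G`,
  `3 · dim{X ∈ 𝔥 : Ad_j X = −X} < 2 · dim 𝔥`) is DERIVED (`involutionDim`) from classification-free Lie theory,
  ALL LANDED in wave 2 of lead c4: `stub_lieSimple` p136887 (ideals of `𝔥` are trivial, from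
  `IsSimpleCompactGroup`: Ad-stability of ideals via `exp(L_X − R_X)`, identity component of a centraliser),
  `stub_weightDecomp` p136929 (joint weight decomposition of `𝔥_ℂ = 𝔥 ⊕ i𝔥` under an abelian `A ≤ 𝔥`, by
  simultaneous diagonalisation of the HS-symmetric commuting family `{i·ad H}`), `stub_abelianThird` p136800
  (+ helpers p136721; `3·dim A < dim 𝔥` for abelian `A` when `dim 𝔥 > 3`: `dim 𝔥 ≥ dim E₀ + |Φ| ≥ 3 dim A`,
  equality excluded by the ideal `E_β ⊔ E_{−β} ⊔ [E_β, E_{−β}]`), `stub_involutionSplit` p137251 (+ helpers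
  p136945; `dim 𝔭 ≤ dim 𝔨 + dim 𝔞` by the swap `θ E_w = E_{−w}`), the glue `stub_involutionGlue` p137062
  (+ `stub_realStructure` p136452), and `stub_rankOneCentral` p137221 (+ helpers p136906; `dim 𝔥 ≤ 3` + simply
  connected ⇒ involutions central — NOT by classification but by path lifting through the tree's
  `rotHom : S³ → SO(3)`: the loop `γ·(jγ)` is null-homotopic in `G`, its image under `Ad : G → SO(𝔥) ⊆ SO(3)`
  lifts to a path ending at `q²` for a lift `q` of `Ad j`, so `q² = 1`, `q = ±1`, `Ad j = 1`, `j` central;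
  this is the ONLY use of `SimplyConnectedSpace`, false for `SO(3)`).

So the floor side is CLOSED and LANDED (v9): `Theorems/ConvexGribovBodyBrascampLiebVacuumSCFloor.lean`
(p137501) proves `involutionDim`, `dimensionGap`, `cubeWitness`, `floorCore` and `coulombGaugeAFloorSC` (= the
disprover's sub-crux `CoulombGaugeAFloor r`, Disproof.lean G6, verbatim shape) for EVERY simply-connected compact
simple `G` and every faithful unitary `r`, sorry-free; this skeleton imports it. The line closes the crux modulo
`stub_up` ALONE; the conditional closing file `Theorems/ConvexGribovBodyBrascampLiebVacuumSC.lean`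
(`BrascampLiebVacuumSC_of_up`, `BrascampLiebVacuumSC_of_susceptibility`) records crux ⇐ UP_SC ⇐
stmt-9442 ∧ stmt-9441.

Stubs: OPEN `stub_up` (UP_SC = FradkinShenkerFlow stmt-9442 ∧ 9441 by the rider `stub_up_of_susceptibility`;
blocked on those existing items) — the ONLY sorry;
everything else LANDED: p124378 p124550 p126464 p127499 p127645 p127813 p128442 p128562 p130498 p130567 p130713
p130807 p130951 p131883 p132704 (c0–c3), p134512 p134625 p134635 p134669 p135288 p135435 (c4 wave 1),
p136452 p136721 p136800 p136887 p136906 p136929 p136945 p137062 p137221 p137251 (c4 wave 2).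
-/

open scoped BigOperators Topology Matrix
open Filter MeasureTheory ProbabilityTheory
open Literature.MathematicalPhysics.QuantumFieldTheory
open Summit.QuantumFields.YangMills.Cruxes.CovarianceBound.SupportWindow
  (froSq coulombF IsCoulMin gluon modeCov supCov wilson4)
open Summit.QuantumFields.YangMills.Theorems.PoincareClustering (hbLaw hbOp)

noncomputable section

namespace Summit.QuantumFields.YangMills.Theorems.BrascampLiebVacuumSC

/-! ### Physics stub: the uniform heat-bath Poincaré inequality UP(β ≥ β₀) -/

/-- **Stub (PHYSICS — UP(β), imported shape).** For simply-connected compact simple `G` and faithful `r`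
there is `β₀` such that for every `β ≥ β₀` there are `C ≥ 0` and `S₀` with, on every torus `(2S+1)⁴`,
`S ≥ S₀`: `Var_μ F ≤ C Σ_ℓ ∫∫ (F(U) − F(U[ℓ ↦ g]))² dν_ℓ^U(g) dμ(U)` for all bounded measurable `F`
(`ν_ℓ^U = hbLaw` the one-link heat-bath law). Verbatim the consequent of
`FradkinShenkerFlow.SusceptibilityToPoincare` under `FiniteSusceptibilityWeakCoupling`
(rider `stub_up_of_susceptibility`). [folklore] -/
theorem stub_up :
    ∀ (G : Type) [Group G] [TopologicalSpace G] [IsTopologicalGroup G] [CompactSpace G]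
    [MeasurableSpace G] [BorelSpace G], IsCompactSimpleLieGroup G → SimplyConnectedSpace G →
    ∀ r : LatticeRep G, ∃ β₀ : ℝ, ∀ β : ℝ, β₀ ≤ β → ∃ C : ℝ, 0 ≤ C ∧ ∃ S₀ : ℕ, ∀ S : ℕ, S₀ ≤ S →
    ∀ F : GaugeConfig 4 (2 * S + 1) G → ℝ, Measurable F → (∃ M : ℝ, ∀ U, |F U| ≤ M) →
      variance F (wilson4 r β S) ≤
        C * ∑ ℓ : Edge 4 (2 * S + 1), ∫ U, ∫ g, (F U - F (Function.update U ℓ g)) ^ 2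
          ∂(hbLaw r.ρ β ℓ U) ∂(wilson4 r β S) := by
  sorry

/-! ### Rider (sorry-free): `stub_up` is route FradkinShenkerFlow's UP(β ≥ β₀) -/

/-- **Rider.** `FiniteSusceptibilityWeakCoupling ∧ SusceptibilityToPoincare` (stmt-9442 ∧ stmt-9441 of route
FradkinShenkerFlow) imply `stub_up` verbatim (with `C ↦ max C 0`, `S₀ := 0`; the simple-connectivity
hypothesis is not used). [folklore] -/
theorem stub_up_of_susceptibility
    (hFS : Summit.QuantumFields.YangMills.Theses.FradkinShenkerFlow.FiniteSusceptibilityWeakCoupling)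
    (hSP : Summit.QuantumFields.YangMills.Theses.FradkinShenkerFlow.SusceptibilityToPoincare) :
    ∀ (G : Type) [Group G] [TopologicalSpace G] [IsTopologicalGroup G] [CompactSpace G]
    [MeasurableSpace G] [BorelSpace G], IsCompactSimpleLieGroup G → SimplyConnectedSpace G →
    ∀ r : LatticeRep G, ∃ β₀ : ℝ, ∀ β : ℝ, β₀ ≤ β → ∃ C : ℝ, 0 ≤ C ∧ ∃ S₀ : ℕ, ∀ S : ℕ, S₀ ≤ S →
    ∀ F : GaugeConfig 4 (2 * S + 1) G → ℝ, Measurable F → (∃ M : ℝ, ∀ U, |F U| ≤ M) →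
      variance F (wilson4 r β S) ≤
        C * ∑ ℓ : Edge 4 (2 * S + 1), ∫ U, ∫ g, (F U - F (Function.update U ℓ g)) ^ 2
          ∂(hbLaw r.ρ β ℓ U) ∂(wilson4 r β S) := by
  intro G _ _ _ _ _ _ hG _ r
  obtain ⟨β₀, hβ₀⟩ := hFS G hG r
  refine ⟨max β₀ 0, fun β hβ => ?_⟩
  have h0 : (0 : ℝ) ≤ β := le_trans (le_max_right _ _) hβ
  obtain ⟨C, hC⟩ := hSP G hG r β h0 (hβ₀ β (le_trans (le_max_left _ _) hβ))
  refine ⟨max C 0, le_max_right _ _, 0, fun S _ F hF hM => ?_⟩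
  refine (hC S F hF hM).trans ?_
  refine mul_le_mul_of_nonneg_right (le_max_left _ _) ?_
  refine Finset.sum_nonneg fun ℓ _ => integral_nonneg fun U => integral_nonneg fun g => sq_nonneg _

/-! ### The floor side, v7: the Haar dimension gap from metric entropy

Notation in the stubs below: `𝕄 = Matrix (Fin r.N) (Fin r.N) ℂ` (or `Fin N`), squared Frobenius norm
`froSq X = Σ_{a,b} ‖X a b‖²`, `exp = NormedSpace.exp` (the matrix exponential), the matrix Lie algebra of
`ρ(G)`: `𝔥 = {X : ∀ t : ℝ, exp (t • X) ∈ Set.range r.ρ}`, and for an involution `j` its `−1`-eigenspace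
`𝔭_j = {X : ρ j * X * ρ j = −X}` (`ρ j = (ρ j)⁻¹` as `j² = 1`). -/

/-! ### The floor side is LANDED: `Theorems/ConvexGribovBodyBrascampLiebVacuumSCFloor.lean` (p137501) —
`involutionDim`, `dimensionGap`, `cubeWitness`, `floorCore`, `coulombGaugeAFloorSC` (imported). -/

/-! ### Composition -/

/-- **The line closes the crux modulo its stubs**: `β₀ := β₀ of UP` (the floor holds at every `β`),
`C(β) := (2 C_UP(β) κ₁(β) + 1) / d(β)`, `S₀ := max`; then `Var f ≤ 2Cκ₁ · dir f ≤ C(β) · d · dir f ≤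
C(β) · Dmax · dir f`. [folklore] -/
theorem BrascampLiebVacuumSC_of :
    Summit.QuantumFields.YangMills.Theses.ConvexGribovBody.BrascampLiebVacuumSC := by
  intro G _ _ _ _ _ _ hG hSC r
  obtain ⟨β₁, h₁⟩ := stub_up G hG hSC r
  refine ⟨β₁, fun β hβ => ?_⟩
  obtain ⟨C, hC0, S₁, hUP⟩ := h₁ β hβ
  obtain ⟨κ₁, hκ0, hHS⟩ := stub_onelinkHS G hG r β
  obtain ⟨d, hd, S₃, hfl⟩ := floorCore G hG hSC r β
  refine ⟨(2 * C * κ₁ + 1) / d, by positivity, max S₁ S₃, fun S hS => ?_⟩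
  intro μ fro coul cov Dmax slope dir f hf₁ hf₂ hf₃
  have hA : ∫ U, (f U - ∫ V, f V ∂μ) ^ 2 ∂μ ≤ 2 * C * κ₁ * dir f :=
    stub_sliceRestriction G r β C κ₁ S hC0 hκ0 (hUP S (le_trans (le_max_left _ _) hS)) (hHS S)
      f hf₁ hf₂ hf₃
  have hred : ∫ U, (⨆ h : {h : Site 4 (2 * S + 1) → G // IsCoulMin r S U h},
      (∑ j : Fin 3, ∑ y : Fin 3 → ZMod (2 * S + 1), froSq (gluon r S U h.1 y j)) /
        ((2 * S + 1 : ℝ) ^ 3)) ∂(wilson4 r β S) ≤ Dmax :=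
    stub_floorReduction G r β S
  have hcore := hfl S (le_trans (le_max_right _ _) hS)
  have hDmax : d ≤ Dmax := hcore.trans hred
  have hdir : 0 ≤ dir f := by
    refine Finset.sum_nonneg fun e _ => ?_
    split_ifs
    · exact integral_nonneg fun U => sq_nonneg _
    · exact le_rfl
  have hCκ : 0 ≤ 2 * C * κ₁ := by positivity
  refine hA.trans ?_
  have h1 : 2 * C * κ₁ ≤ (2 * C * κ₁ + 1) / d * Dmax := by
    rw [div_mul_eq_mul_div, le_div_iff₀ hd]
    nlinarith [mul_le_mul_of_nonneg_left hDmax (by positivity : (0 : ℝ) ≤ 2 * C * κ₁ + 1)]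
  exact mul_le_mul_of_nonneg_right h1 hdir

end Summit.QuantumFields.YangMills.Theorems.BrascampLiebVacuumSC

end
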